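import Summits.Ventures.Crystal3D.Theorems.StickyWulffConstantCoaxialWallLawOneFccChargeBound
import Summits.Ventures.Crystal3D.Theorems.StickyWulffConstantTextureLiminfTexShadowCertificateDefs
import Literature.MathematicalPhysics.StatisticalMechanics.BarlowBilayers
import HarnessLib

/-!
# The ONE-FCC F_layer: the MIRRORED CELL (file (l₁)) — plates, payers and slice volumes under `p ↦ bM p + h e₃`

HONEST FRAMING. Venture `Summits/Ventures/Crystal3D` (cell `crystal3d-full`); helper `--supports` the crux `CoaxialWallLaw`
(stmt-Ventures-19481, REGISTERED line `WallLedgerF`) in its role as owner of lane T's debt T-F2 / F_layer, OneFcc half (cf-p1 (civ)/(cxx);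
memo HOME/wall-19481-p1/g16/TWO-FAMILY-LEDGER-g16.md).  Elementary; census-free, standard axioms; nothing about the crux is claimed;
F-C1 not moved.

The per-cell law `oneFcc_core_cell` is stated for a FAULTED BOTTOM plate; the case "fcc below, faulted above" is the same cell seen in the
mirror `M p = basalMirror p + h e₃` (heights `z ↦ h − z`, slice `[0,1] ↦ [h−1, h]`).  This file provides the dictionary:
* `mirror_apply_two`, `mirror_lat`, `mirror_mirror`, `mem_image_mirror_iff`;
* `mirror_mem_stacking_iff`, `mirror_mem_laySlab_iff` — `M(stacking L s σ) = stacking (L ≫ bM) (M s) σ`, same for the open slabs;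
* `mirrorCell_cell`, `mirrorCell_plate_bottom`, `mirrorCell_plate_top` — the mirrored cell is a cell with the plates exchanged;
* `mirrorCell_deg_eq`, `mirrorCell_payerSum_eq` — contact numbers and the payer sum `Σ_{PAY} (12 − deg)` are mirror-invariant;
* `volume_mirrorSlice_inter_laySlab` — `|S_{h−1} ∩ laySlab (L ≫ bM) (M s) i| = |S_0 ∩ laySlab L s i|`.
WHAT THIS IS NOT: any count or law; F-C1 not moved.
-/

noncomputable section

namespace Summit.Ventures.Crystal3D.Theorems

open MeasureTheory Summit.Ventures.Crystal3D Finset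
open Literature.MathematicalPhysics.StatisticalMechanics (basalMirror basalMirror_apply_coord basalMirror_basalMirror barlowStacking)
open Summit.Ventures.Crystal3D.Cruxes.TextureLiminf.TexShadow (E3 stacking laySlab)
open scoped InnerProductSpace

/-- Coordinates of the basal mirror. -/
theorem basalMirror_coords (v : E3) : basalMirror v 0 = v 0 ∧ basalMirror v 1 = v 1 ∧ basalMirror v 2 = -v 2 :=
  ⟨by rw [basalMirror_apply_coord]; exact if_neg (by decide), by rw [basalMirror_apply_coord]; exact if_neg (by decide),
    by rw [basalMirror_apply_coord, if_pos rfl]⟩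

/-- `bM (h e₃) = −h e₃`. -/
theorem basalMirror_smul_e₃ (h : ℝ) :
    basalMirror (h • EuclideanSpace.single (2 : Fin 3) (1 : ℝ)) = -(h • EuclideanSpace.single (2 : Fin 3) (1 : ℝ)) := by
  ext l
  rw [basalMirror_apply_coord, PiLp.neg_apply]
  split_ifs with hl
  · rw [hl]
  · fin_cases l <;> simp_all

/-- Height under the cell mirror: `(M p)₂ = h − p₂`. -/
theorem mirror_apply_two (h : ℝ) (p : E3) : (basalMirror p + h • EuclideanSpace.single (2 : Fin 3) (1 : ℝ)) 2 = h - p 2 := by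
  have h2 : (h • EuclideanSpace.single (2 : Fin 3) (1 : ℝ) : E3) 2 = h := by simp
  rw [PiLp.add_apply, (basalMirror_coords p).2.2, h2]
  ring

/-- Lateral radius under the cell mirror. -/
theorem mirror_lat (h : ℝ) (p : E3) :
    (basalMirror p + h • EuclideanSpace.single (2 : Fin 3) (1 : ℝ)) 0 ^ 2 + (basalMirror p + h • EuclideanSpace.single (2 : Fin 3) (1 : ℝ)) 1 ^ 2 =
      p 0 ^ 2 + p 1 ^ 2 := by
  have h0 : (h • EuclideanSpace.single (2 : Fin 3) (1 : ℝ) : E3) 0 = 0 := by simp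
  have h1 : (h • EuclideanSpace.single (2 : Fin 3) (1 : ℝ) : E3) 1 = 0 := by simp
  rw [PiLp.add_apply, PiLp.add_apply, (basalMirror_coords p).1, (basalMirror_coords p).2.1, h0, h1, add_zero, add_zero]

/-- The cell mirror is an involution. -/
theorem mirror_mirror (h : ℝ) (p : E3) :
    basalMirror (basalMirror p + h • EuclideanSpace.single (2 : Fin 3) (1 : ℝ)) + h • EuclideanSpace.single (2 : Fin 3) (1 : ℝ) = p := by
  rw [map_add, basalMirror_basalMirror, basalMirror_smul_e₃]; abel

/-- Membership in a mirrored finite set. -/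
theorem mem_image_mirror_iff (h : ℝ) (Q : Finset E3) (p : E3) :
    p ∈ Q.image (fun q => basalMirror q + h • EuclideanSpace.single (2 : Fin 3) (1 : ℝ)) ↔
      basalMirror p + h • EuclideanSpace.single (2 : Fin 3) (1 : ℝ) ∈ Q := by
  rw [mem_image]
  constructor
  · rintro ⟨x, hx, hxp⟩; rw [← hxp, mirror_mirror]; exact hx
  · intro hp; exact ⟨_, hp, mirror_mirror h p⟩

/-- The cell mirror is injective. -/
theorem mirror_injective (h : ℝ) : Function.Injective (fun q : E3 => basalMirror q + h • EuclideanSpace.single (2 : Fin 3) (1 : ℝ)) :=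
  fun p q hpq => by
    have := congrArg (fun x : E3 => basalMirror x + h • EuclideanSpace.single (2 : Fin 3) (1 : ℝ)) hpq
    simpa only [mirror_mirror] using this

/-- The cell mirror preserves distances. -/
theorem mirror_dist (h : ℝ) (p q : E3) :
    dist (basalMirror p + h • EuclideanSpace.single (2 : Fin 3) (1 : ℝ)) (basalMirror q + h • EuclideanSpace.single (2 : Fin 3) (1 : ℝ)) =
      dist p q := by
  rw [dist_add_right, LinearIsometryEquiv.dist_map]

/-- **Mirror of a Barlow plate**: `M p ∈ stacking L s σ ↔ p ∈ stacking (L ≫ bM) (M s) σ`. -/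
theorem mirror_mem_stacking_iff (h : ℝ) (L : E3 ≃ₗᵢ[ℝ] E3) (s : E3) (σ : ℤ → ℤ) (p : E3) :
    basalMirror p + h • EuclideanSpace.single (2 : Fin 3) (1 : ℝ) ∈ stacking L s σ ↔
      p ∈ stacking (L.trans basalMirror) (basalMirror s + h • EuclideanSpace.single (2 : Fin 3) (1 : ℝ)) σ := by
  simp only [stacking, Set.mem_image, LinearIsometryEquiv.trans_apply]
  constructor
  · rintro ⟨r, hr, hrp⟩
    refine ⟨r, hr, ?_⟩
    have h1 := congrArg (fun q : E3 => basalMirror q + h • EuclideanSpace.single (2 : Fin 3) (1 : ℝ)) hrp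
    simp only [mirror_mirror] at h1
    rw [← h1, map_add]; abel
  · rintro ⟨r, hr, rfl⟩
    refine ⟨r, hr, ?_⟩
    rw [map_add, map_add, basalMirror_basalMirror, basalMirror_basalMirror, basalMirror_smul_e₃]; abel

/-- **Mirror of an open slab**: `M p ∈ laySlab L s i ↔ p ∈ laySlab (L ≫ bM) (M s) i`. -/
theorem mirror_mem_laySlab_iff (h : ℝ) (L : E3 ≃ₗᵢ[ℝ] E3) (s : E3) (i : ℤ) (p : E3) :
    basalMirror p + h • EuclideanSpace.single (2 : Fin 3) (1 : ℝ) ∈ laySlab L s i ↔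
      p ∈ laySlab (L.trans basalMirror) (basalMirror s + h • EuclideanSpace.single (2 : Fin 3) (1 : ℝ)) i := by
  simp only [laySlab, Set.mem_image, LinearIsometryEquiv.trans_apply]
  constructor
  · rintro ⟨r, hr, hrp⟩
    refine ⟨r, hr, ?_⟩
    have h1 := congrArg (fun q : E3 => basalMirror q + h • EuclideanSpace.single (2 : Fin 3) (1 : ℝ)) hrp
    simp only [mirror_mirror] at h1
    rw [← h1, map_add]; abel
  · rintro ⟨r, hr, rfl⟩
    refine ⟨r, hr, ?_⟩
    rw [map_add, map_add, basalMirror_basalMirror, basalMirror_basalMirror, basalMirror_smul_e₃]; abel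

/-- The mirrored cell is a clamped cell. -/
theorem mirrorCell_cell (X : Finset E3) (R₀ h ρ : ℝ)
    (hcell : ∀ p ∈ X, -(2 * R₀) ≤ p 2 ∧ p 2 ≤ h + 2 * R₀ ∧ p 0 ^ 2 + p 1 ^ 2 ≤ ρ ^ 2) :
    ∀ p ∈ X.image (fun q => basalMirror q + h • EuclideanSpace.single (2 : Fin 3) (1 : ℝ)),
      -(2 * R₀) ≤ p 2 ∧ p 2 ≤ h + 2 * R₀ ∧ p 0 ^ 2 + p 1 ^ 2 ≤ ρ ^ 2 := by
  intro p hp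
  obtain ⟨h1, h2, h3⟩ := hcell _ ((mem_image_mirror_iff h X p).1 hp)
  rw [mirror_apply_two] at h1 h2
  rw [mirror_lat] at h3
  exact ⟨by linarith, by linarith, h3⟩

/-- The mirrored TOP plate is the BOTTOM plate of the mirrored cell. -/
theorem mirrorCell_plate_bottom (P₂ : Finset E3) (L₂ : E3 ≃ₗᵢ[ℝ] E3) (s₂ : E3) (σ₂ : ℤ → ℤ) (R₀ h ρ : ℝ)
    (hP₂ : ∀ p, p ∈ P₂ ↔ (p ∈ stacking L₂ s₂ σ₂ ∧ h + R₀ ≤ p 2 ∧ p 2 ≤ h + 2 * R₀ ∧ p 0 ^ 2 + p 1 ^ 2 ≤ ρ ^ 2)) :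
    ∀ p, p ∈ P₂.image (fun q => basalMirror q + h • EuclideanSpace.single (2 : Fin 3) (1 : ℝ)) ↔
      (p ∈ stacking (L₂.trans basalMirror) (basalMirror s₂ + h • EuclideanSpace.single (2 : Fin 3) (1 : ℝ)) σ₂ ∧
        -(2 * R₀) ≤ p 2 ∧ p 2 ≤ -R₀ ∧ p 0 ^ 2 + p 1 ^ 2 ≤ ρ ^ 2) := by
  intro p
  rw [mem_image_mirror_iff, hP₂, mirror_apply_two, mirror_lat, mirror_mem_stacking_iff]
  constructor
  · rintro ⟨h1, h2, h3, h4⟩; exact ⟨h1, by linarith, by linarith, h4⟩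
  · rintro ⟨h1, h2, h3, h4⟩; exact ⟨h1, by linarith, by linarith, h4⟩

/-- The mirrored BOTTOM plate is the TOP plate of the mirrored cell. -/
theorem mirrorCell_plate_top (P₁ : Finset E3) (L₁ : E3 ≃ₗᵢ[ℝ] E3) (s₁ : E3) (σ₁ : ℤ → ℤ) (R₀ h ρ : ℝ)
    (hP₁ : ∀ p, p ∈ P₁ ↔ (p ∈ stacking L₁ s₁ σ₁ ∧ -(2 * R₀) ≤ p 2 ∧ p 2 ≤ -R₀ ∧ p 0 ^ 2 + p 1 ^ 2 ≤ ρ ^ 2)) :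
    ∀ p, p ∈ P₁.image (fun q => basalMirror q + h • EuclideanSpace.single (2 : Fin 3) (1 : ℝ)) ↔
      (p ∈ stacking (L₁.trans basalMirror) (basalMirror s₁ + h • EuclideanSpace.single (2 : Fin 3) (1 : ℝ)) σ₁ ∧
        h + R₀ ≤ p 2 ∧ p 2 ≤ h + 2 * R₀ ∧ p 0 ^ 2 + p 1 ^ 2 ≤ ρ ^ 2) := by
  intro p
  rw [mem_image_mirror_iff, hP₁, mirror_apply_two, mirror_lat, mirror_mem_stacking_iff]
  constructor
  · rintro ⟨h1, h2, h3, h4⟩; exact ⟨h1, by linarith, by linarith, h4⟩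
  · rintro ⟨h1, h2, h3, h4⟩; exact ⟨h1, by linarith, by linarith, h4⟩

open scoped Classical in
/-- **Contact numbers are mirror-invariant.** -/
theorem mirrorCell_deg_eq (X : Finset E3) (h : ℝ) (x : E3) :
    ((X.image (fun q => basalMirror q + h • EuclideanSpace.single (2 : Fin 3) (1 : ℝ))).filter fun q =>
        dist (basalMirror x + h • EuclideanSpace.single (2 : Fin 3) (1 : ℝ)) q = 1).card =
      (X.filter fun q => dist x q = 1).card := by
  rw [filter_image, card_image_of_injective _ (mirror_injective h)]
  congr 1
  refine filter_congr fun q _ => ?_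
  simp only [mirror_dist]

open scoped Classical in
/-- **The payer sum is mirror-invariant.** -/
theorem mirrorCell_payerSum_eq (X : Finset E3) (R₀ h : ℝ) :
    ∑ y ∈ (X.image (fun q => basalMirror q + h • EuclideanSpace.single (2 : Fin 3) (1 : ℝ))).filter (fun y =>
        ((X.image (fun q => basalMirror q + h • EuclideanSpace.single (2 : Fin 3) (1 : ℝ))).filter fun q => dist y q = 1).card ≠ 12 ∧
          -R₀ - 2 ≤ y 2 ∧ y 2 ≤ h + R₀ + 2),
        ((12 : ℝ) - (((X.image (fun q => basalMirror q + h • EuclideanSpace.single (2 : Fin 3) (1 : ℝ))).filter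
          fun q => dist y q = 1).card : ℝ)) =
      ∑ y ∈ X.filter (fun y => (X.filter fun q => dist y q = 1).card ≠ 12 ∧ -R₀ - 2 ≤ y 2 ∧ y 2 ≤ h + R₀ + 2),
        ((12 : ℝ) - ((X.filter fun q => dist y q = 1).card : ℝ)) := by
  rw [filter_image, sum_image fun a _ b _ hab => mirror_injective h hab]
  refine sum_congr (filter_congr fun x _ => ?_) fun x _ => by rw [mirrorCell_deg_eq]
  show ((X.image (fun q => basalMirror q + h • EuclideanSpace.single (2 : Fin 3) (1 : ℝ))).filter fun q =>
      dist (basalMirror x + h • EuclideanSpace.single (2 : Fin 3) (1 : ℝ)) q = 1).card ≠ 12 ∧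
      -R₀ - 2 ≤ (basalMirror x + h • EuclideanSpace.single (2 : Fin 3) (1 : ℝ)) 2 ∧
      (basalMirror x + h • EuclideanSpace.single (2 : Fin 3) (1 : ℝ)) 2 ≤ h + R₀ + 2 ↔ _
  rw [mirrorCell_deg_eq, mirror_apply_two]
  constructor
  · rintro ⟨h1, h2, h3⟩; exact ⟨h1, by linarith, by linarith⟩
  · rintro ⟨h1, h2, h3⟩; exact ⟨h1, by linarith, by linarith⟩

/-- **The slice volumes are mirror-invariant**: `|S_{h−1} ∩ laySlab (L ≫ bM) (M s) i| = |S_0 ∩ laySlab L s i|`. -/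
theorem volume_mirrorSlice_inter_laySlab (L : E3 ≃ₗᵢ[ℝ] E3) (s : E3) (i : ℤ) (ρ h : ℝ) :
    volume ({q : E3 | h - 1 ≤ q 2 ∧ q 2 ≤ h - 1 + 1 ∧ q 0 ^ 2 + q 1 ^ 2 ≤ ρ ^ 2} ∩
        laySlab (L.trans basalMirror) (basalMirror s + h • EuclideanSpace.single (2 : Fin 3) (1 : ℝ)) i) =
      volume ({q : E3 | 0 ≤ q 2 ∧ q 2 ≤ 1 ∧ q 0 ^ 2 + q 1 ^ 2 ≤ ρ ^ 2} ∩ laySlab L s i) := by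
  set c : E3 := h • EuclideanSpace.single (2 : Fin 3) (1 : ℝ) with hc
  have hset : {q : E3 | h - 1 ≤ q 2 ∧ q 2 ≤ h - 1 + 1 ∧ q 0 ^ 2 + q 1 ^ 2 ≤ ρ ^ 2} ∩
      laySlab (L.trans basalMirror) (basalMirror s + c) i =
      basalMirror ⁻¹' ((fun q : E3 => q + c) ⁻¹' ({q : E3 | 0 ≤ q 2 ∧ q 2 ≤ 1 ∧ q 0 ^ 2 + q 1 ^ 2 ≤ ρ ^ 2} ∩ laySlab L s i)) := by
    ext q
    simp only [Set.mem_inter_iff, Set.mem_setOf_eq, Set.mem_preimage]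
    rw [mirror_apply_two, mirror_lat, mirror_mem_laySlab_iff]
    constructor
    · rintro ⟨⟨h1, h2, h3⟩, h4⟩; exact ⟨⟨by linarith, by linarith, h3⟩, h4⟩
    · rintro ⟨⟨h1, h2, h3⟩, h4⟩; exact ⟨⟨by linarith, by linarith, h3⟩, h4⟩
  have hT : MeasurableSet ({q : E3 | 0 ≤ q 2 ∧ q 2 ≤ 1 ∧ q 0 ^ 2 + q 1 ^ 2 ≤ ρ ^ 2} ∩ laySlab L s i) := by
    have := measurableSet_shiftedSlice ρ 0
    simp only [zero_add] at this
    exact this.inter (measurableSet_laySlab L s i)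
  have hU : MeasurableSet ((fun q : E3 => q + c) ⁻¹' ({q : E3 | 0 ≤ q 2 ∧ q 2 ≤ 1 ∧ q 0 ^ 2 + q 1 ^ 2 ≤ ρ ^ 2} ∩ laySlab L s i)) :=
    hT.preimage (measurable_add_const c)
  rw [hset, (basalMirror.measurePreserving).measure_preimage hU.nullMeasurableSet, measure_preimage_add_right]

end Summit.Ventures.Crystal3D.Theorems

end
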